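/-
Copyright (c) 2026. All rights reserved.
Released under Apache 2.0 license as described in the file LICENSE.
-/
import Summits.BirchSwinnertonDyer.BirchSwinnertonDyer.Theorems.ByReductionTypeAtTwoRankOneSigmaHeightNeronDenominator

/-!
# Two Néron doublings modulo `2¹⁰` (route `ByReductionTypeAtTwo`, crux `RankOneAtTwoBigImageOddLocal`, §54 of the analytic lens memo)

Pure integer arithmetic behind the level-one `η`-height law modulo `64` (typed candidate `EtaHeightLogFreeLawModSixtyFourAtTwo`):
for a Weierstrass equation with integer coefficients and `a₁ = 0`, Néron's duplication numerator and denominator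
`N(a, D) = a⁴ − b₄a²D² − 2b₆aD³ − b₈D⁴`, `M(a, D) = D(4a³ + b₂a²D + 2b₄aD² + b₆D³)` (`x(2P) = N/M` for `x(P) = a/D`,
[cite: SilvermanAEC2009, III.2.3(d)]) satisfy, whenever `a ≡ 1 (mod 4)` and `D = 4m` with `m` odd (the shape of a level-one
point: `‖x‖₂ = 4`),

  `N(N(a, D), M(a, D)) ≡ 1 + 16(a − 1) − 8(a − 1)² + 384a₄ − 512a₃ (mod 1024)`.

In words: the `x`-numerator of `4Q` is congruent modulo `2¹⁰` to an explicit quadratic polynomial in the `x`-numerator of the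
level-one point `Q`.  Combined with the effective Tate formula at `k = 2` (`⟨Q,Q⟩ ≡ 16⁻¹ log₂ num x(4Q) (mod 2⁷)`,
`ByReductionTypeAtTwoRankOneSigmaHeightTateRate`) this gives the `η`-height of a level-one point modulo `64`
(file `ByReductionTypeAtTwoRankOneSigmaHeightLogFreeLawModSixtyFour`).

## Main statements

* `eight_dvd_sq_sub_one_of_odd`: `8 ∣ n² − 1` for odd `n`.
* `neronNumerator_eq_pow_four_add`: first doubling, `N(a, 4m) = a⁴ + 32·U` with `U` explicit.
* `neronNumerator_iterate_two_congr`: the displayed congruence modulo `1024`.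
-/

namespace Summit.BirchSwinnertonDyer.BirchSwinnertonDyer.Theorems

namespace NaiveSigmaLogAtTwo

/-- `8 ∣ n² − 1` for an odd integer `n`. -/
theorem eight_dvd_sq_sub_one_of_odd {n : ℤ} (hn : Odd n) : (8 : ℤ) ∣ n ^ 2 - 1 := by
  obtain ⟨j, rfl⟩ := hn
  obtain ⟨i, hi⟩ := Int.even_mul_succ_self j
  exact ⟨i, by linear_combination 4 * hi⟩

/-- First Néron doubling at a level-one point: with `D = 4m`, `N(a, D) = a⁴ + 32·U` where
`U = −a₄a²m² − 4b₆am³ − 8b₈m⁴` (`a₁ = 0`: `b₄ = 2a₄`, `b₆ = a₃² + 4a₆`, `b₈ = 4a₂a₆ + a₂a₃² − a₄²`).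
[cite: SilvermanAEC2009, III.2.3(d)] -/
theorem neronNumerator_eq_pow_four_add (A₂ A₃ A₄ A₆ a m : ℤ) :
    a ^ 4 - 2 * A₄ * a ^ 2 * (4 * m) ^ 2 - 2 * (A₃ ^ 2 + 4 * A₆) * a * (4 * m) ^ 3
        - (4 * A₂ * A₆ + A₂ * A₃ ^ 2 - A₄ ^ 2) * (4 * m) ^ 4 =
      a ^ 4 + 32 * (-A₄ * a ^ 2 * m ^ 2 - 4 * (A₃ ^ 2 + 4 * A₆) * a * m ^ 3
        - 8 * (4 * A₂ * A₆ + A₂ * A₃ ^ 2 - A₄ ^ 2) * m ^ 4) := by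
  ring

/-- First Néron doubling, denominator: with `D = 4m`, `M(a, D) = 16·m·(a³ + 4a₂a²m + 16a₄am² + 16b₆m³)`.
[cite: SilvermanAEC2009, III.2.3(d)] -/
theorem neronDenominator_eq_sixteen_mul (A₂ A₃ A₄ A₆ a m : ℤ) :
    4 * m * (4 * a ^ 3 + 4 * A₂ * a ^ 2 * (4 * m) + 2 * (2 * A₄) * a * (4 * m) ^ 2 + (A₃ ^ 2 + 4 * A₆) * (4 * m) ^ 3) =
      16 * (m * (a ^ 3 + 4 * A₂ * a ^ 2 * m + 16 * A₄ * a * m ^ 2 + 16 * (A₃ ^ 2 + 4 * A₆) * m ^ 3)) := by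
  ring

/-- **Two Néron doublings modulo `2¹⁰`.**  For integers `a₂, a₃, a₄, a₆` (`a₁ = 0`), `a ≡ 1 (mod 4)` and `D = 4m` with `m` odd, put
`a′ = N(a, D)`, `D′ = M(a, D)`, `a″ = N(a′, D′)`; then `a″ ≡ 1 + 16(a − 1) − 8(a − 1)² + 384a₄ − 512a₃ (mod 1024)`.
Proof: `a′ = a⁴ + 32U`, `D′ = 16M′` with `a′`, `M′` odd; `a″ ≡ a′⁴ − 512a₄(a′M′)² ≡ a¹⁶ + 128a¹²U − 512a₄ (mod 1024)`;
`a¹² ≡ 1 (mod 8)`, `128U ≡ −128a₄ − 512a₃ (mod 1024)` (odd squares are `1 mod 8`, `a₃² ≡ a₃ mod 2`), and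
`a¹⁶ ≡ 1 + 16(a − 1) − 8(a − 1)² (mod 1024)` for `a ≡ 1 (mod 4)`. [cite: SilvermanAEC2009, III.2.3(d), VII.2] -/
theorem neronNumerator_iterate_two_congr (A₂ A₃ A₄ A₆ a D a' D' a'' : ℤ) (ha : (4 : ℤ) ∣ a - 1)
    (hD : ∃ m : ℤ, Odd m ∧ D = 4 * m)
    (ha' : a' = a ^ 4 - 2 * A₄ * a ^ 2 * D ^ 2 - 2 * (A₃ ^ 2 + 4 * A₆) * a * D ^ 3
      - (4 * A₂ * A₆ + A₂ * A₃ ^ 2 - A₄ ^ 2) * D ^ 4)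
    (hD' : D' = D * (4 * a ^ 3 + 4 * A₂ * a ^ 2 * D + 2 * (2 * A₄) * a * D ^ 2 + (A₃ ^ 2 + 4 * A₆) * D ^ 3))
    (ha'' : a'' = a' ^ 4 - 2 * A₄ * a' ^ 2 * D' ^ 2 - 2 * (A₃ ^ 2 + 4 * A₆) * a' * D' ^ 3
      - (4 * A₂ * A₆ + A₂ * A₃ ^ 2 - A₄ ^ 2) * D' ^ 4) :
    (1024 : ℤ) ∣ a'' - 1 - (16 * (a - 1) - 8 * (a - 1) ^ 2 + 384 * A₄ - 512 * A₃) := by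
  obtain ⟨u, hu⟩ := ha
  obtain ⟨m, hm, hDm⟩ := hD
  have hau : a = 4 * u + 1 := by linarith
  -- the auxiliary quantities of the first doubling
  obtain ⟨U, hU⟩ : ∃ U : ℤ, U = -A₄ * a ^ 2 * m ^ 2 - 4 * (A₃ ^ 2 + 4 * A₆) * a * m ^ 3
      - 8 * (4 * A₂ * A₆ + A₂ * A₃ ^ 2 - A₄ ^ 2) * m ^ 4 := ⟨_, rfl⟩
  obtain ⟨M, hM⟩ : ∃ M : ℤ, M = m * (a ^ 3 + 4 * A₂ * a ^ 2 * m + 16 * A₄ * a * m ^ 2 + 16 * (A₃ ^ 2 + 4 * A₆) * m ^ 3) :=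
    ⟨_, rfl⟩
  have e1 : a' = a ^ 4 + 32 * U := by rw [ha', hDm, hU]; exact neronNumerator_eq_pow_four_add A₂ A₃ A₄ A₆ a m
  have e2 : D' = 16 * M := by rw [hD', hDm, hM]; exact neronDenominator_eq_sixteen_mul A₂ A₃ A₄ A₆ a m
  -- second doubling modulo `1024`
  have e3 : a'' = a' ^ 4 - 512 * A₄ * a' ^ 2 * M ^ 2
      + 1024 * (-8 * (A₃ ^ 2 + 4 * A₆) * a' * M ^ 3 - 64 * (4 * A₂ * A₆ + A₂ * A₃ ^ 2 - A₄ ^ 2) * M ^ 4) := by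
    rw [ha'', e2]; ring
  -- parities
  have hao : Odd a := ⟨2 * u, by linarith⟩
  have ha'o : Odd a' := by
    have h2 : a' = 2 * (16 * U) + a ^ 4 := by rw [e1]; ring
    rw [h2]; exact (even_two_mul _).add_odd hao.pow
  have hMo : Odd M := by
    have hM2 : M = 2 * (m * (2 * A₂ * a ^ 2 * m + 8 * A₄ * a * m ^ 2 + 8 * (A₃ ^ 2 + 4 * A₆) * m ^ 3)) + m * a ^ 3 := by
      rw [hM]; ring
    rw [hM2]; exact (even_two_mul _).add_odd (hm.mul hao.pow)
  -- the six pieces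
  have p1 : (1024 : ℤ) ∣ a' ^ 4 - a ^ 16 - 128 * a ^ 12 * U :=
    ⟨6 * a ^ 8 * U ^ 2 + 128 * a ^ 4 * U ^ 3 + 1024 * U ^ 4, by rw [e1]; ring⟩
  have p2 : (1024 : ℤ) ∣ 512 * A₄ * ((a' * M) ^ 2 - 1) := by
    obtain ⟨i, hi⟩ := ((ha'o.mul hMo).pow (n := 2)).sub_odd odd_one
    exact ⟨A₄ * i, by rw [hi]; ring⟩
  have p4 : (1024 : ℤ) ∣ 128 * U * (a ^ 12 - 1) := by
    obtain ⟨c, hc⟩ := eight_dvd_sq_sub_one_of_odd hao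
    exact ⟨U * c * (a ^ 10 + a ^ 8 + a ^ 6 + a ^ 4 + a ^ 2 + 1), by
      linear_combination (128 * U * (a ^ 10 + a ^ 8 + a ^ 6 + a ^ 4 + a ^ 2 + 1)) * hc⟩
  have p5 : (1024 : ℤ) ∣ a ^ 16 - 1 - (16 * (a - 1) - 8 * (a - 1) ^ 2) :=
    ⟨2 * u ^ 2 + 35 * u ^ 3 + 455 * u ^ 4 + 4368 * u ^ 5 + 32032 * u ^ 6 + 183040 * u ^ 7 + 823680 * u ^ 8
      + 2928640 * u ^ 9 + 8200192 * u ^ 10 + 17891328 * u ^ 11 + 29818880 * u ^ 12 + 36700160 * u ^ 13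
      + 31457280 * u ^ 14 + 16777216 * u ^ 15 + 4194304 * u ^ 16, by rw [hau]; ring⟩
  have p6 : (1024 : ℤ) ∣ 128 * U - 896 * A₄ + 512 * A₃ := by
    obtain ⟨c, hc⟩ := eight_dvd_sq_sub_one_of_odd (hao.mul hm)
    obtain ⟨j, hj⟩ := hao.mul (hm.pow (n := 3))
    obtain ⟨i, hi⟩ := Int.even_mul_succ_self (A₃ - 1)
    exact ⟨-A₄ * c - A₄ - (A₃ ^ 2 + 4 * A₆) * j - i - 2 * A₆ - (4 * A₂ * A₆ + A₂ * A₃ ^ 2 - A₄ ^ 2) * m ^ 4, by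
      linear_combination 128 * hU - 128 * A₄ * hc - 512 * (A₃ ^ 2 + 4 * A₆) * hj - 512 * hi⟩
  -- assemble
  have key : a'' - 1 - (16 * (a - 1) - 8 * (a - 1) ^ 2 + 384 * A₄ - 512 * A₃) =
      (a' ^ 4 - a ^ 16 - 128 * a ^ 12 * U) - 512 * A₄ * ((a' * M) ^ 2 - 1)
        + 1024 * (-8 * (A₃ ^ 2 + 4 * A₆) * a' * M ^ 3 - 64 * (4 * A₂ * A₆ + A₂ * A₃ ^ 2 - A₄ ^ 2) * M ^ 4)
        + 128 * U * (a ^ 12 - 1) + (a ^ 16 - 1 - (16 * (a - 1) - 8 * (a - 1) ^ 2))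
        + (128 * U - 896 * A₄ + 512 * A₃) := by
    rw [e3]; ring
  rw [key]
  exact dvd_add (dvd_add (dvd_add (dvd_add (dvd_sub p1 p2) (dvd_mul_right 1024 _)) p4) p5) p6

end NaiveSigmaLogAtTwo

end Summit.BirchSwinnertonDyer.BirchSwinnertonDyer.Theorems
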